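import Mathlib
import HarnessLib
import Summits.ValiantsHypothesis.Statement
import Summits.ValiantsHypothesis.ValiantsHypothesis.Theses.SymmetryDial
import Literature.Computability.AlgebraicComplexity.SymmetricArithCircuit
import Literature.Computability.AlgebraicComplexity.DawarWilsenach2025Proofs

/-!
# SymmetryDial — glue of the A-side mechanism split (`SymHardAffineOfSupportSplit`)

Decomposition workshop decomp-valiant, cycle 1 (VALIANT), lens 1 «representation-theoretic obstruction
splitting», generation 3.  LADDER-Valiant rung 0: nothing here proves VP ≠ VNP.

Route item `stmt-ValiantsHypothesis-23712`:
`SymHardAffineOfSupportSplit : AffineSupportTheorem → SymHardAffineSupported → SymHardAffine`.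

Mechanism (orbit–stabiliser).  In a `Γ`-symmetric labelled circuit (Dawar–Wilsenach), the set of
`γ ∈ Γ` admitting SOME automorphism extension fixing a gate `g` is a subgroup (`exists_gateStab`), and its
index is at most the number of gates (`index_le_card_of_gateStab`: choose one extension `ext γ` per `γ`;
equal values `ext γ g = ext γ' g` force `γ⁻¹γ'` into the stabiliser, so cosets inject into gates).  For a
family with `≤ t(2^d) ≤ (2^d)^c + c` gates the affine support theorem (A₁) therefore makes every gate
`k(c)`-supported, and supported hardness (A₂) excludes the family (`symHardAffineOfSupportSplit_holds`).
(The converse `SymHardAffine → SymHardAffineSupported` — A₂ is weaker than A, hence S-implied — and the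
exactness `AffineSupportTheorem → (SymHardAffine ↔ SymHardAffineSupported)` are one-liners kept in the
workshop node file; this tree file carries only the glue item.)
-/

set_option linter.dupNamespace false

namespace Summit.ValiantsHypothesis.ValiantsHypothesis.Theorems.SymmetryDialSupportSplit

open Literature.Computability.AlgebraicComplexity
open Summit.ValiantsHypothesis.ValiantsHypothesis.Theses.SymmetryDial

section GateStab

variable {K₀ : Type*} {X : Type*} {Y : Type*} {G : Type*}
variable {Γ : Type*} [Group Γ] [MulAction Γ X] [MulAction Γ Y]

/-- The stabiliser of a gate IN THE SYMMETRY GROUP exists as a subgroup: the elements of `Γ` having some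
extension to a circuit automorphism fixing `g`. -/
theorem exists_gateStab (C : LabelledArithCircuit K₀ X Y G) (g : G) :
    ∃ S : Subgroup Γ, ∀ γ : Γ, γ ∈ S ↔ ∃ π : Equiv.Perm G, C.IsAutomorphismExtending γ π ∧ π g = g := by
  refine ⟨{ carrier := {γ | ∃ π : Equiv.Perm G, C.IsAutomorphismExtending γ π ∧ π g = g}
            one_mem' := ⟨1, C.isAutomorphismExtending_one, rfl⟩
            mul_mem' := ?_
            inv_mem' := ?_ }, fun γ => Iff.rfl⟩
  · rintro a b ⟨π, hπ, hπg⟩ ⟨π', hπ', hπ'g⟩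
    exact ⟨π * π', hπ'.trans hπ, by rw [Equiv.Perm.mul_apply, hπ'g, hπg]⟩
  · rintro a ⟨π, hπ, hπg⟩
    refine ⟨π⁻¹, hπ.inv, ?_⟩
    rw [Equiv.Perm.inv_def, Equiv.symm_apply_eq]
    exact hπg.symm

/-- **Orbit–stabiliser bound.**  In a `Γ`-symmetric circuit a subgroup containing the stabiliser of a
gate has index at most the number of gates. -/
theorem index_le_card_of_gateStab [Fintype G] (C : LabelledArithCircuit K₀ X Y G)
    (hsym : C.IsSymmetric Γ) (g : G) (S : Subgroup Γ)
    (hS : ∀ γ : Γ, (∃ π : Equiv.Perm G, C.IsAutomorphismExtending γ π ∧ π g = g) → γ ∈ S) :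
    S.index ≤ Fintype.card G := by
  classical
  choose ext hext using hsym
  have key : ∀ γ γ' : Γ, ext γ g = ext γ' g →
      (QuotientGroup.mk γ : Γ ⧸ S) = QuotientGroup.mk γ' := by
    intro γ γ' h
    rw [QuotientGroup.eq]
    refine hS _ ⟨(ext γ)⁻¹ * ext γ', (hext γ').trans (hext γ).inv, ?_⟩
    rw [Equiv.Perm.mul_apply, ← h]
    simp
  let φ : Γ → G := fun γ => ext γ g
  let ψ : Set.range φ → Γ ⧸ S := fun v => QuotientGroup.mk (Classical.choose v.2)
  have hψ : Function.Surjective ψ := by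
    intro q
    induction q using QuotientGroup.induction_on with
    | H γ =>
      refine ⟨⟨φ γ, γ, rfl⟩, ?_⟩
      have hc := Classical.choose_spec (⟨γ, rfl⟩ : φ γ ∈ Set.range φ)
      exact key _ _ hc
  calc S.index = Nat.card (Γ ⧸ S) := Subgroup.index_eq_card _
    _ ≤ Nat.card (Set.range φ) := Nat.card_le_card_of_surjective ψ hψ
    _ ≤ Nat.card G := Nat.card_le_card_of_injective (Subtype.val) Subtype.val_injective
    _ = Fintype.card G := Nat.card_eq_fintype_card

end GateStab

/-- **The glue item, proved**: `AffineSupportTheorem → SymHardAffineSupported → SymHardAffine`. -/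
theorem symHardAffineOfSupportSplit_holds :
    Summit.ValiantsHypothesis.ValiantsHypothesis.Theses.SymmetryDial.SymHardAffineOfSupportSplit := by
  rintro h₁ h₂ ⟨t, ⟨c, hc⟩, hC⟩
  obtain ⟨k, hk⟩ := h₁ c
  refine h₂ k ⟨t, ⟨c, hc⟩, fun d => ?_⟩
  obtain ⟨G, hG, C, hsym, heval, hcard⟩ := hC d
  refine ⟨G, hG, C, hsym, heval, hcard, fun g => ?_⟩
  obtain ⟨S, hS⟩ := exists_gateStab (Γ := ↥(Subgroup.closure {σ : Equiv.Perm (Fin d → Fin 2) |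
    ∀ x y z : Fin d → Fin 2, σ (x + y + z) = σ x + σ y + σ z})) C g
  have hidx : S.index ≤ (2 ^ d) ^ c + c :=
    (index_le_card_of_gateStab C hsym g S (fun γ h => (hS γ).2 h)).trans (hcard.trans (hc _))
  obtain ⟨U, W, hU, hW, hFix⟩ := hk d S hidx
  exact ⟨U, W, hU, hW, fun σ hu hv => (hS σ).1 (hFix σ hu hv)⟩

end Summit.ValiantsHypothesis.ValiantsHypothesis.Theorems.SymmetryDialSupportSplit
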